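import Mathlib

/-!
# Tier4/Common/HaarProductIntegralMul — the integral of a PRODUCT function along `G ≃ₜ* H₁ × H₂` is the product of the
two integrals (no integrability hypothesis), and its `c •` version for `μ = c • (e.symm)_*(ν₁ ⊗ ν₂)`

Blind re-derivation cell `pub-hodge-repro`, Tier 4 (README §9–§10), seat t4-typer-1 (gen 2).  Target tree path
`lean/Summits/Ventures/HodgeRepro/Tier4/Common/HaarProductIntegralMul.lean`.  Imports Mathlib only; the companion of
`Tier4/Common/HaarProductTransport.lean` (p694668: (5)–(7) of C-L4-TORUSPROD), not imported here — both files know nothing of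
the cell's adelic objects.

WHAT IS TYPED — the GENERIC core of plan-4's Parts B and C (S14443: C-L4-CONVPROD `conv_eq_mul_of_isProductFn`, and the
`IsProductFn` bookkeeping of C-L4-PROJPROD / PRODINT), for any continuous group isomorphism `e : G ≃ₜ* H₁ × H₂` of topological
groups with Borel σ-algebras (`H₂` second countable so that `H₁ × H₂` is Borel — one factor suffices), `ν₁`, `ν₂` s-finite (every Haar measure
of a locally compact second-countable group is):
* **`integral_map_symm_prod_mul`**: `∫ x, F₁ (e x).1 * F₂ (e x).2 ∂(Measure.map e.symm (ν₁.prod ν₂)) = (∫ a, F₁ a ∂ν₁) * ∫ b, F₂ b ∂ν₂`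
  — Mathlib's `integral_prod_mul` (which needs NO integrability: a non-integrable factor makes both sides `0`) transported
  along the homeomorphism `e.symm` by `integral_map_equiv`;
* **`integral_eq_smul_mul_integral`**: for `μ = c • Measure.map e.symm (ν₁.prod ν₂)` and any `F` with
  `F x = F₁ (e x).1 * F₂ (e x).2` pointwise, `∫ x, F x ∂μ = (c : ℝ) • ((∫ a, F₁ a ∂ν₁) * ∫ b, F₂ b ∂ν₂)`.
At `e := gaSplit W` with `(gaSplit W) g = (ofInfPart g, ofFinPart g)` and `F₁ y₁ := e₁ y₁ * f₁ (y₁⁻¹ x₁)`, `F₂ y₂ := e₂ y₂ *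
f₂ (y₂⁻¹ x₂)` this is the splitting `conv W μ e f x = c • (convInf · convFin)` of a product test function (CONVPROD);
at `torusSplit` the analogous splitting of a toric integrand.

Nothing here says anything about the status of the Hodge conjecture for CM abelian varieties, which is NOT proved
(HC_CM is NOT proved by anyone in this repository).
-/

set_option autoImplicit false

noncomputable section

open MeasureTheory Measure Filter Topology
open scoped NNReal ENNReal

namespace Summit.Ventures.HodgeRepro.Tier4.Common

section HaarProductIntegralMul

variable {G H₁ H₂ : Type*}
  [Group G] [TopologicalSpace G] [MeasurableSpace G] [BorelSpace G]
  [Group H₁] [TopologicalSpace H₁] [MeasurableSpace H₁] [BorelSpace H₁]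
  [Group H₂] [TopologicalSpace H₂] [MeasurableSpace H₂] [BorelSpace H₂] [SecondCountableTopology H₂]

/-- **The integral of a product function along `e : G ≃ₜ* H₁ × H₂` is the product of the integrals** — against the
push-forward `(e.symm)_*(ν₁ ⊗ ν₂)`, for s-finite `ν₁`, `ν₂`, with NO integrability hypothesis (Mathlib `integral_prod_mul`
transported along the homeomorphism). -/
theorem integral_map_symm_prod_mul (e : G ≃ₜ* H₁ × H₂) (ν₁ : Measure H₁) [SFinite ν₁] (ν₂ : Measure H₂) [SFinite ν₂]
    (F₁ : H₁ → ℂ) (F₂ : H₂ → ℂ) :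
    ∫ x, F₁ (e x).1 * F₂ (e x).2 ∂(Measure.map e.symm (ν₁.prod ν₂)) = (∫ a, F₁ a ∂ν₁) * ∫ b, F₂ b ∂ν₂ := by
  have hmeq : Measure.map e.symm (ν₁.prod ν₂) =
      Measure.map (e.symm.toHomeomorph.toMeasurableEquiv) (ν₁.prod ν₂) := rfl
  rw [hmeq, integral_map_equiv]
  have h : ∀ p : H₁ × H₂, F₁ (e (e.symm.toHomeomorph.toMeasurableEquiv p)).1 *
      F₂ (e (e.symm.toHomeomorph.toMeasurableEquiv p)).2 = F₁ p.1 * F₂ p.2 := by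
    intro p
    show F₁ (e (e.symm p)).1 * F₂ (e (e.symm p)).2 = F₁ p.1 * F₂ p.2
    rw [e.apply_symm_apply]
  simp_rw [h]
  exact integral_prod_mul F₁ F₂

/-- **The integral of a pointwise product function against `μ = c • (e.symm)_*(ν₁ ⊗ ν₂)` is `c` times the product of the
two integrals** — no integrability hypothesis; the shape consumed by the convolution / projector splittings of product test
functions (`F x = F₁ (e x).1 * F₂ (e x).2` for every `x`). -/
theorem integral_eq_smul_mul_integral (e : G ≃ₜ* H₁ × H₂) (μ : Measure G)
    (ν₁ : Measure H₁) [SFinite ν₁] (ν₂ : Measure H₂) [SFinite ν₂]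
    (c : ℝ≥0) (hc : μ = c • Measure.map e.symm (ν₁.prod ν₂)) (F : G → ℂ) (F₁ : H₁ → ℂ) (F₂ : H₂ → ℂ)
    (hF : ∀ x, F x = F₁ (e x).1 * F₂ (e x).2) :
    ∫ x, F x ∂μ = (c : ℝ) • ((∫ a, F₁ a ∂ν₁) * ∫ b, F₂ b ∂ν₂) := by
  subst hc
  rw [integral_smul_nnreal_measure, NNReal.smul_def]
  congr 1
  simp_rw [hF]
  exact integral_map_symm_prod_mul e ν₁ ν₂ F₁ F₂

end HaarProductIntegralMul

end Summit.Ventures.HodgeRepro.Tier4.Common
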